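import Summits.BirchSwinnertonDyer.BirchSwinnertonDyer.Theses.EisensteinPrimes
import Summits.BirchSwinnertonDyer.BirchSwinnertonDyer.Theorems.Rank1ResidualX1Defs

/-!
# Defect-calculus / congruence-orbit sketch (idea seat g22) for crux 5
`EisensteinPrimes.MazurMCOnX1RankZero` (stmt-BirchSwinnertonDyer-19035).

NOT a line on the crux (no `MazurMCOnX1RankZero_of`). Outcome of the g22 ideation pass: 0 new mechanism
cards (the cone g0–g21 is closed under the 21 levers examined, NOTES.md ## Candidate levers). This file
types the two SEARCH-CLOSING statements the pass produced and proves the two kernel facts it leans on.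

* `defect_pinning` — the arithmetic core of every known lower-bound road at an Eisenstein prime
  («merged-piece principle»): non-negative defects `d_i = A_i − a_i` (Kato: `a_i ≤ A_i`, i.e.
  `ord_p char Sel ≤ ord_p L_p` piecewise) summing to `0` over a MERGED object (BDP / Heegner main
  conjecture over an imaginary quadratic `K`: Keller–Yin = crux 2; the in-route H5 and double-twist roads)
  vanish one by one. The memo's census of merged objects: imaginary-quadratic base change is the ONLY
  one with an exact formula; real-quadratic inert base change keeps the wall (`anom_inert_normTrace`);
  the mod-`p` congruence orbit has no anchor (`NoCongruenceAnchorOnX1RankZero`).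
* `ModPCongruentOutside`, `CongruenceOrbitAnchor`, `NoCongruenceAnchorOnX1RankZero` (P2): for a
  rank-0 X1 pair `(W,p)` (`ρ̄^ss = ψ ⊕ ωψ⁻¹`, `ψ` even, `ψ(p) = 1`) NO curve congruent to `W` mod `p`
  outside a finite set of primes is reducible-good and either non-anomalous (Castella–Grossi–Skinner
  2025 Thm D would apply) or of Greenberg–Vatsal parity (GV 2000 Thm 1.3 would apply): Brauer–Nesbitt +
  Chebotarev give the same `ψ`; `Anom ⟺ ψ(p) = 1`; `GVPar ⟺ ψ odd`. Candidate THEOREM (informal proof in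
  the memo §2); typed here as the statement that closes every «transport the main conjecture along
  Eisenstein congruences / level raising / Hida or companion members» line (barrier note B-g22-1).
  Desk falsifier F-g22-1 (this folder `fals/orbit_anchor.py`): congruence orbits of all reducible
  classes `N < 2·10⁴`, `p ∈ {3,5,7,13}`, by `a_ℓ mod p` for good `ℓ ≤ 150`: 0 orbits mixing an anomalous
  with a non-anomalous good class, 0 orbits mixing `ψ` even with `ψ` odd (numbers in the memo).
* `anom_inert_normTrace` (B-g22-5): `p ∣ a_p − 1 ⟹ p ∣ (a_p² − 2p) − 1`, i.e. the norm-Frobenius trace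
  `a_𝔭(E/F) = a_p² − 2p` at a prime `p` inert in a quadratic field `F` is again anomalous: real-quadratic
  «merged pieces» stay inside the reducible-anomalous wall.
-/

namespace Summit.BirchSwinnertonDyer.BirchSwinnertonDyer.Cruxes.MazurMCOnX1RankZero.DefectCalculusG22

open Literature.NumberTheory.EllipticCurves Literature.NumberTheory.EllipticCurves.Rank1Residual
open WeierstrassCurve

/-! ### 1. Merged-piece principle (kernel arithmetic) -/

/-- **Defect pinning, two pieces.** If `a ≤ A`, `b ≤ B` (two one-sided divisibilities, Kato) and the
merged object is exact (`A + B ≤ a + b`, e.g. BSD_p / the main conjecture for `E/K = E ⊕ E^K`), then each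
piece is exact. This is the whole logical content of «BSD_p(E/K) + Kato(E) + Kato(E^K) ⟹ BSD_p(E)». -/
theorem defect_pinning {a A b B : ℕ} (ha : a ≤ A) (hb : b ≤ B) (hsum : A + B ≤ a + b) :
    a = A ∧ b = B := by omega

/-- **Defect pinning, finitely many pieces** (orbit version: a merged object over a finite index set). -/
theorem defect_pinning_sum {ι : Type*} (s : Finset ι) (a A : ι → ℕ) (h : ∀ i ∈ s, a i ≤ A i)
    (hsum : ∑ i ∈ s, A i ≤ ∑ i ∈ s, a i) : ∀ i ∈ s, a i = A i := by
  have hle : ∑ i ∈ s, a i ≤ ∑ i ∈ s, A i := Finset.sum_le_sum h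
  have heq : ∑ i ∈ s, a i = ∑ i ∈ s, A i := le_antisymm hle hsum
  exact (Finset.sum_eq_sum_iff_of_le h).1 heq

/-! ### 2. The congruence orbit of a rank-0 X1 pair has no printed anchor (P2) -/

/-- `W` and `W'` (globally minimal models) are congruent mod `p` outside the finite set `S`:
`a_ℓ(W) ≡ a_ℓ(W') (mod p)` for every prime `ℓ ∉ S` (trace form; by Brauer–Nesbitt–Chebotarev this is
`ρ̄_{W,p}^ss ≅ ρ̄_{W',p}^ss` as soon as `S ⊇ {p} ∪ primes of N_W N_{W'}`). -/
def ModPCongruentOutside (W W' : WeierstrassCurve ℚ) [W.IsGloballyMinimal] [W'.IsGloballyMinimal]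
    (p : ℕ) (S : Finset ℕ) : Prop :=
  ∀ ℓ : ℕ, ℓ.Prime → ℓ ∉ S → (p : ℤ) ∣ W.frobeniusTrace ℓ - W'.frobeniusTrace ℓ

/-- An ANCHOR in the mod-`p` congruence orbit of `W`: a congruent curve `W'`, reducible and of good
reduction at `p`, to which a PRINTED cyclotomic main-conjecture theorem applies — either non-anomalous
(Castella–Grossi–Skinner 2025 Thm D) or of Greenberg–Vatsal parity (GV 2000 Thm 1.3 / 3.10). -/
def CongruenceOrbitAnchor (W : WeierstrassCurve ℚ) [W.IsGloballyMinimal] (p : ℕ) [Fact p.Prime] : Prop :=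
  ∃ (W' : WeierstrassCurve ℚ) (_ : W'.IsElliptic) (_ : W'.IsGloballyMinimal) (S : Finset ℕ),
    ModPCongruentOutside W W' p S ∧ Red W' p ∧ Good W' p ∧ (¬ Anom W' p ∨ GVPar W' p)

/-- **P2 (candidate theorem; search-closing statement).** A rank-0 X1 pair has NO anchor in its
congruence orbit: every congruent reducible good curve is again anomalous and of non-GV parity
(`ψ` even, `ψ(p) = 1` are orbit invariants). Informal proof: memo §2. Consequence: no «transport along
Eisenstein congruences» line can import CGS Thm D or GV Thm 1.3 into class X1 at rank 0. -/
def NoCongruenceAnchorOnX1RankZero : Prop :=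
  ∀ (W : WeierstrassCurve ℚ) [W.IsElliptic] [W.IsGloballyMinimal] (p : ℕ) [Fact p.Prime],
    ClassX1 W p → W.analyticRank = 0 → ¬ CongruenceOrbitAnchor W p

/-- The pair itself is never its own anchor (the `S = ∅`, `W' = W` instance of P2, provable now). -/
theorem not_anchor_self (W : WeierstrassCurve ℚ) [W.IsElliptic] [W.IsGloballyMinimal] (p : ℕ)
    [Fact p.Prime] (hX1 : ClassX1 W p) (hr : W.analyticRank = 0) :
    ¬ (¬ Anom W p ∨ GVPar W p) := by
  rintro (hna | hgv)
  · exact hna hX1.2.2.2.1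
  · exact hX1.2.2.2.2 ⟨hr, hgv⟩

/-! ### 3. Inert quadratic base change keeps anomaly (B-g22-5) -/

/-- `p ∣ a − 1 ⟹ p ∣ (a² − 2p) − 1`: the trace of the norm Frobenius `Frob_p² ` is `a_p² − 2p`. -/
theorem dvd_normTrace_sub_one {p a : ℤ} (h : p ∣ a - 1) : p ∣ (a ^ 2 - 2 * p) - 1 := by
  have e : (a ^ 2 - 2 * p) - 1 = (a - 1) * (a + 1) - p * 2 := by ring
  rw [e]
  exact dvd_sub (dvd_mul_of_dvd_left h _) (dvd_mul_right p 2)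

/-- For an anomalous pair `(W, p)` the degree-2 Frobenius trace `a_p² − 2p` (= `a_𝔭(W/F)` for `p` inert in
a quadratic field `F`) is again `≡ 1 (mod p)`: the real-quadratic / inert «merged piece» `W/F` is still
reducible-anomalous, so no printed engine over `F` applies either. -/
theorem anom_inert_normTrace (W : WeierstrassCurve ℚ) (p : ℕ) [Fact p.Prime] [W.IsGloballyMinimal]
    (h : Anom W p) : (p : ℤ) ∣ (W.frobeniusTrace p ^ 2 - 2 * p) - 1 :=
  dvd_normTrace_sub_one h.2.2

end Summit.BirchSwinnertonDyer.BirchSwinnertonDyer.Cruxes.MazurMCOnX1RankZero.DefectCalculusG22
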